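import Summits.SmoothPoincare4.SmoothPoincare4.Theorems.ConvexBisectionAcyclicBisectionExistsBeltLongitudeFraming
import Summits.SmoothPoincare4.SmoothPoincare4.Theorems.ConvexBisectionAcyclicBisectionExistsBeltTubeComparison
import Summits.SmoothPoincare4.SmoothPoincare4.Theorems.ConvexBisectionAcyclicBisectionExistsBeltBasePush
import HarnessLib

/-!
# From the end of the belt-circle slide to the page-adapted tube, in `∂P` (stages (3a)+(3c) of node T3c-1
# pushed into the attached manifold)
(node T3c-1 `node_belt_isotopic_pushoff` of the sub-goal T3 of stub `stub_steinRealisation` (NF6), line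
`modp-braid-orbits`, crux `ConvexBisection.AcyclicBisectionExists`, item stmt-SmoothPoincare4-10508;
wave 3, worker Z5, lead c5)

The two bricks `helper_belt_slideFraming_homotopic` (stage (3a), in `∂P`) and `helper_belt_tubeComparison`
(stage (3c), in `∂M`) are put together in `∂P`: for multi-attachment data `D` of 2-handles `h` on a compact
`M` (`P = M ∪ handles`), a handle `i`, a direction flag `b`, a second tube `Φ₂` of `∂M` around the
attaching circle of `h i` with the hypotheses of `CircleTube.exists_diffeotopy_reflect` and small target,
and all small radii `r`: **the end framed knot of the belt-circle slide
`(θ ↦ jA (h̄ᵢ (tubeLongitudePt b r θ)), d(jA) dh̄ᵢ (Dι⁻¹ W))` (`helper_belt_slide`,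
`helper_belt_slideFramingVector`) is isotopic through knots of `∂P` — all stages `jA` of points of
`h̄ᵢ(T)` off the core — carrying its framing, to the framed knot `θ ↦ jA (Φ₂ (uDir b θ, reflFibre s (r θ)))`
with framing `d(jA) (d/dε|₀ Φ₂ (uDir b θ, reflFibre s (r θ) + ε reflFibre s (θ²)))`**
(`exists_slideEnd_to_tube`): the constant isotopy carrying the framing homotopy of stage (3a), followed by
the `jA`-push (`…BeltBasePush.lean`) of the tube comparison of stage (3c).

* §1 points of `h̄ᵢ(T)` off the core of `h̄ᵢ` are off all cores; §2 **`exists_slideEnd_to_tube`**;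
* §3 packaging `tubeEndPoint`, `tubeEndFraming`, `slideEndVec` and registered helper `helper_belt_slideToTube`.

Everything is proved; no named facts.

## References
* A. A. Kosinski, *Differential Manifolds*, Academic Press (1993), III (3.5), VI §6. [Kosinski1993]
-/

noncomputable section

-- the prescribed namespace `Summit.<P>.<Sub>.…` duplicates `SmoothPoincare4` (P = Sub)
set_option linter.dupNamespace false

open scoped Manifold ContDiff Topology
open Set Function Metric Filter Bundle

namespace Summit.SmoothPoincare4.SmoothPoincare4.Theorems.AcyclicBisectionExists.ModpBraidOrbits

open Literature.Topology.FourManifolds Literature.Topology.FourManifolds.HandleAttachingMap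
  Literature.Geometry.Symplectic

variable {ι : Type*} [Finite ι] {M : Type} [TopologicalSpace M] [T2Space M] [CompactSpace M]
  [ChartedSpace (EuclideanHalfSpace 4) M] [IsManifold (𝓡∂ 4) ∞ M] {h : ι → HandleAttachingMap 3 2 M}
  {P : Type*} [TopologicalSpace P] [T2Space P] [ChartedSpace (EuclideanHalfSpace 4) P] [IsManifold (𝓡∂ 4) ∞ P]

/-! ### §1 Points of one tube off its core are off all cores -/

omit [CompactSpace M] [IsManifold (𝓡∂ 4) ∞ M] in
/-- A point of `h̄ᵢ(T)` off the core of `h̄ᵢ` is off all cores (the ranges are pairwise disjoint).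
[folklore] -/
theorem mem_coresComplement_of_mem_range (hd : Pairwise fun i j => Disjoint (range (h i).toFun) (range (h j).toFun))
    (i : ι) {x : M} (hx : x ∈ range (h i).toFun) (hx' : x ∉ (h i).core) : x ∈ coresComplement h := by
  rw [mem_coresComplement]
  intro j hj
  by_cases hij : j = i
  · subst hij; exact hx' hj
  · obtain ⟨y, -, hy⟩ := hj
    exact Set.disjoint_left.1 (hd hij) ⟨y, hy⟩ hx

/-! ### §2 From the end of the slide to the second tube, in `∂P` -/

/-- **Stages (3a)+(3c) in `∂P`.**  See the module docstring. [cite: Kosinski1993, III (3.5) and VI §6] -/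
theorem exists_slideEnd_to_tube (D : MultiAttachmentData h (𝓡∂ 4) P) (i : ι) (b : Bool)
    {Φ₂ : CircleTube ↥((𝓡∂ 4).boundary M)} (hcore : ∀ θ, (h i).boundaryTube.core θ = Φ₂.core θ)
    {s : ℝ} (hs : s ^ 2 = 1) (hsgn : ∀ x, 0 < s * CircleTube.frameSign (h i).boundaryTube Φ₂ x)
    {β : sphere (0 : EuclideanSpace ℝ (Fin 2)) 1 → ℝ} (hβ : ContMDiff (𝓡 1) 𝓘(ℝ, ℝ) ∞ β)
    (hang : ∀ x, CircleTube.frameVec (h i).boundaryTube Φ₂ x = rotPlane (β x) planeE0)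
    (hsmall : Φ₂.toHomeo.target ⊆ (h i).boundaryTube.toHomeo ''
      ((univ : Set (sphere (0 : EuclideanSpace ℝ (Fin 2)) 1)) ×ˢ ball (0 : EuclideanSpace ℝ (Fin 2)) (1 / 4))) :
    ∃ r₀ : ℝ, 0 < r₀ ∧ r₀ ≤ 1 / 4 ∧ ∀ r : ℝ, 0 < r → r < r₀ →
      ∃ (hmem : ∀ θ : sphere (0 : EuclideanSpace ℝ (Fin 2)) 1, (h i).toFun (tubeLongitudePt b r θ) ∈ coresComplement h)
        (hmem' : ∀ θ : sphere (0 : EuclideanSpace ℝ (Fin 2)) 1,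
          (((Φ₂.toHomeo (uDir b θ, reflFibre s (r • (θ : EuclideanSpace ℝ (Fin 2))))) : ↥((𝓡∂ 4).boundary M)) : M) ∈
            coresComplement h)
        (Ψ : KnotIsotopyInBoundary (fun θ => D.jA ⟨(h i).toFun (tubeLongitudePt b r θ), hmem θ⟩)
          (fun θ => D.jA ⟨(((Φ₂.toHomeo (uDir b θ, reflFibre s (r • (θ : EuclideanSpace ℝ (Fin 2))))) :
            ↥((𝓡∂ 4).boundary M)) : M), hmem' θ⟩))
        (νt : ℝ → sphere (0 : EuclideanSpace ℝ (Fin 2)) 1 → EuclideanSpace ℝ (Fin 4)),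
        (∀ t θ, ∃ a : ↥(coresComplement h), (a : M) ∈ range (h i).toFun ∧ Ψ.toFun t θ = D.jA a) ∧
        IsFramingAlong Ψ
          (fun θ => mfderiv (𝓡∂ 4) (𝓡∂ 4) (fun a : ↥(coresComplement h) => D.jA a)
            ⟨(h i).toFun (tubeLongitudePt b r θ), hmem θ⟩
            (mfderiv (𝓡∂ 4) (𝓡∂ 4) (h i).toFun (tubeLongitudePt b r θ)
              ((closedBallCoeDeriv ((tubeLongitudePt b r θ : ↥(handleTube 3 2)) :
                closedBall (0 : EuclideanSpace ℝ (Fin 4)) 1)).symm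
                (WithLp.toLp 2 (frameW (slideSign b) r ((θ : EuclideanSpace ℝ (Fin 2)) 0) ((θ : EuclideanSpace ℝ (Fin 2)) 1))))))
          νt ∧
        ∀ θ, νt 1 θ = mfderiv (𝓡∂ 4) (𝓡∂ 4) D.jA
          ⟨(((Φ₂.toHomeo (uDir b θ, reflFibre s (r • (θ : EuclideanSpace ℝ (Fin 2))))) : ↥((𝓡∂ 4).boundary M)) : M), hmem' θ⟩
          (mfderiv 𝓘(ℝ, ℝ) (𝓡∂ 4) (fun ε : ℝ => ((Φ₂.toHomeo (uDir b θ,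
            reflFibre s (r • (θ : EuclideanSpace ℝ (Fin 2))) + ε • reflFibre s (sqDir θ)) : ↥((𝓡∂ 4).boundary M)) : M))
            0 (1 : ℝ)) := by
  obtain ⟨r₀, hr₀, hr₀4, H⟩ := exists_tubeComparison (h i) b hcore hs hsgn hβ hang hsmall
  refine ⟨r₀, hr₀, hr₀4, fun r h0 hr => ?_⟩
  obtain ⟨ΨM, νtM, hcM, hfrM, hendM⟩ := H r h0 hr
  have hr2 : r ≤ 1 / 2 := by linarith
  have hr1 : r < 1 := by linarith
  -- all stages are off all cores
  have hc : ∀ t u, ΨM.toFun t u ∈ coresComplement h := fun t u =>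
    mem_coresComplement_of_mem_range D.disjoint i (hcM t u).1 (hcM t u).2
  have hmem : ∀ θ : sphere (0 : EuclideanSpace ℝ (Fin 2)) 1, (h i).toFun (tubeLongitudePt b r θ) ∈ coresComplement h :=
    fun θ => longitude_mem_coresComplement i b D.disjoint h0 hr1 θ
  have hmem' : ∀ θ : sphere (0 : EuclideanSpace ℝ (Fin 2)) 1,
      (((Φ₂.toHomeo (uDir b θ, reflFibre s (r • (θ : EuclideanSpace ℝ (Fin 2))))) : ↥((𝓡∂ 4).boundary M)) : M) ∈
        coresComplement h := fun θ => by
    have h1 := hc 1 θ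
    rwa [ΨM.map_one] at h1
  -- stage (3a): the framing homotopy, as a framing family along the constant isotopy
  obtain ⟨hKP, νt₁, hfr₁, hend₁⟩ := framingHomotopic_slideEnd_fibre D i b h0 hr2
  -- stage (3c), pushed through `jA`
  have hfr₂ := isFramingAlong_jA_push D hc hfrM
  refine ⟨hmem, hmem', (KnotIsotopyInBoundary.refl hKP).trans' (isotopyJA D ΨM hc), _, fun t θ => ?_,
    hfr₁.trans' (hend₁ ▸ hfr₂), fun θ => ?_⟩
  · rw [KnotIsotopyInBoundary.trans'_toFun]
    split_ifs with ht
    · exact ⟨⟨_, hmem θ⟩, mem_range_self _, rfl⟩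
    · exact ⟨⟨_, hc _ θ⟩, (hcM _ θ).1, rfl⟩
  · show (if (1 : ℝ) ≤ 1 / 2 then νt₁ (KnotIsotopyInBoundary.ρ₁ 1)
      else (fun t u => mfderiv (𝓡∂ 4) (𝓡∂ 4) D.jA ⟨ΨM.toFun t u, hc t u⟩ (νtM t u)) (KnotIsotopyInBoundary.ρ₂ 1)) θ = _
    rw [if_neg (by norm_num), KnotIsotopyInBoundary.ρ₂_one]
    show mfderiv (𝓡∂ 4) (𝓡∂ 4) D.jA ⟨ΨM.toFun 1 θ, hc 1 θ⟩ (νtM 1 θ) = _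
    have key : ∀ (G : sphere (0 : EuclideanSpace ℝ (Fin 2)) 1 → M) (hG : ∀ u, G u ∈ coresComplement h)
        (_ : G = fun θ => (((Φ₂.toHomeo (uDir b θ, reflFibre s (r • (θ : EuclideanSpace ℝ (Fin 2))))) :
          ↥((𝓡∂ 4).boundary M)) : M)) (v : EuclideanSpace ℝ (Fin 4)),
        mfderiv (𝓡∂ 4) (𝓡∂ 4) D.jA ⟨G θ, hG θ⟩ v =
          mfderiv (𝓡∂ 4) (𝓡∂ 4) D.jA ⟨(((Φ₂.toHomeo (uDir b θ, reflFibre s (r • (θ : EuclideanSpace ℝ (Fin 2))))) :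
            ↥((𝓡∂ 4).boundary M)) : M), hmem' θ⟩ v := by
      intro G hG e v; subst e; rfl
    rw [key _ (hc 1) ΨM.map_one, hendM θ]


/-! ### §3 Packaging of the end data and registered helper -/

/-- **The end point `Φ₂ (uDir b θ, reflFibre s (r θ))` of the tube comparison**, as a point of `M`.
[folklore] -/
def tubeEndPoint (Φ₂ : CircleTube ↥((𝓡∂ 4).boundary M)) (b : Bool) (s r : ℝ)
    (θ : sphere (0 : EuclideanSpace ℝ (Fin 2)) 1) : M :=
  (((Φ₂.toHomeo (uDir b θ, reflFibre s (r • (θ : EuclideanSpace ℝ (Fin 2))))) : ↥((𝓡∂ 4).boundary M)) : M)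

/-- **The end framing of the tube comparison**: the velocity at `ε = 0` of
`ε ↦ Φ₂ (uDir b θ, reflFibre s (r θ) + ε reflFibre s (θ²))`, a vector of `TM`. [folklore] -/
def tubeEndFraming (Φ₂ : CircleTube ↥((𝓡∂ 4).boundary M)) (b : Bool) (s r : ℝ)
    (θ : sphere (0 : EuclideanSpace ℝ (Fin 2)) 1) : EuclideanSpace ℝ (Fin 4) :=
  mfderiv 𝓘(ℝ, ℝ) (𝓡∂ 4) (fun ε : ℝ => ((Φ₂.toHomeo (uDir b θ,
    reflFibre s (r • (θ : EuclideanSpace ℝ (Fin 2))) + ε • reflFibre s (sqDir θ)) : ↥((𝓡∂ 4).boundary M)) : M)) 0 (1 : ℝ)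

/-- **The end framing vector `W(θ)` of the belt-circle slide** (`frameW` of `helper_belt_slideFramingVector`),
as a vector of `ℝ⁴`. [folklore] -/
def slideEndVec (b : Bool) (r : ℝ) (θ : sphere (0 : EuclideanSpace ℝ (Fin 2)) 1) : EuclideanSpace ℝ (Fin 4) :=
  WithLp.toLp 2 (frameW (slideSign b) r ((θ : EuclideanSpace ℝ (Fin 2)) 0) ((θ : EuclideanSpace ℝ (Fin 2)) 1))

/-- **Registered helper `helper_belt_slideToTube` (node T3c-1 of NF6 `stub_steinRealisation`, stages
(3a)+(3c) in `∂P`, wave 3, lead c5).**  For multi-attachment data `D` of 2-handles `h` on a compact `M`, a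
handle `i`, a direction flag `b`, a tube `Φ₂` of `∂M` around the attaching circle of `h i` with the
hypotheses of `CircleTube.exists_diffeotopy_reflect` against `(h i).boundaryTube` and target inside
`(h i).boundaryTube (𝕊¹ × B(0,1/4))`: for all small `r > 0`, the end framed knot
`(θ ↦ jA (h̄ᵢ (tubeLongitudePt b r θ)), d(jA) dh̄ᵢ Dι⁻¹ W(θ))` of the belt-circle slide (`helper_belt_slide`,
`helper_belt_slideFramingVector`) is isotopic through knots of `∂P` — every stage the `jA`-image of a point
of `h̄ᵢ(T)` off the cores — carrying its framing, to `θ ↦ jA (Φ₂ (uDir b θ, reflFibre s (r θ)))` framed by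
`d(jA)` of the velocity of `ε ↦ Φ₂ (uDir b θ, reflFibre s (r θ) + ε reflFibre s (θ²))`.
[cite: Kosinski1993, III (3.5) and VI §6] -/
theorem helper_belt_slideToTube :
    ∀ {ι : Type} [Finite ι] {M : Type} [TopologicalSpace M] [T2Space M] [CompactSpace M]
      [ChartedSpace (EuclideanHalfSpace 4) M] [IsManifold (𝓡∂ 4) ∞ M]
      {h : ι → Literature.Topology.FourManifolds.HandleAttachingMap 3 2 M}
      {P : Type} [TopologicalSpace P] [T2Space P] [ChartedSpace (EuclideanHalfSpace 4) P] [IsManifold (𝓡∂ 4) ∞ P]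
      (D : Literature.Topology.FourManifolds.HandleAttachingMap.MultiAttachmentData h (𝓡∂ 4) P) (i : ι) (b : Bool)
      (Φ₂ : Literature.Topology.FourManifolds.CircleTube ↥((𝓡∂ 4).boundary M))
      (_ : ∀ θ, (h i).boundaryTube.core θ = Φ₂.core θ) (s : ℝ) (_ : s ^ 2 = 1)
      (_ : ∀ x, 0 < s * Literature.Topology.FourManifolds.CircleTube.frameSign (h i).boundaryTube Φ₂ x)
      (β : Metric.sphere (0 : EuclideanSpace ℝ (Fin 2)) 1 → ℝ) (_ : ContMDiff (𝓡 1) 𝓘(ℝ, ℝ) ∞ β)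
      (_ : ∀ x, Literature.Topology.FourManifolds.CircleTube.frameVec (h i).boundaryTube Φ₂ x =
        Literature.Topology.FourManifolds.rotPlane (β x) Literature.Topology.FourManifolds.planeE0)
      (_ : Φ₂.toHomeo.target ⊆ (h i).boundaryTube.toHomeo ''
        ((Set.univ : Set (Metric.sphere (0 : EuclideanSpace ℝ (Fin 2)) 1)) ×ˢ Metric.ball (0 : EuclideanSpace ℝ (Fin 2)) (1 / 4))),
      ∃ r₀ : ℝ, 0 < r₀ ∧ r₀ ≤ 1 / 4 ∧ ∀ r : ℝ, 0 < r → r < r₀ →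
        ∃ (hmem : ∀ θ : Metric.sphere (0 : EuclideanSpace ℝ (Fin 2)) 1,
            (h i).toFun (Summit.SmoothPoincare4.SmoothPoincare4.Theorems.AcyclicBisectionExists.ModpBraidOrbits.tubeLongitudePt b r θ) ∈ Literature.Topology.FourManifolds.HandleAttachingMap.coresComplement h)
          (hmem' : ∀ θ : Metric.sphere (0 : EuclideanSpace ℝ (Fin 2)) 1,
            Summit.SmoothPoincare4.SmoothPoincare4.Theorems.AcyclicBisectionExists.ModpBraidOrbits.tubeEndPoint Φ₂ b s r θ ∈ Literature.Topology.FourManifolds.HandleAttachingMap.coresComplement h)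
          (Ψ : Literature.Geometry.Symplectic.KnotIsotopyInBoundary
            (fun θ => D.jA ⟨(h i).toFun (Summit.SmoothPoincare4.SmoothPoincare4.Theorems.AcyclicBisectionExists.ModpBraidOrbits.tubeLongitudePt b r θ), hmem θ⟩)
            (fun θ => D.jA ⟨Summit.SmoothPoincare4.SmoothPoincare4.Theorems.AcyclicBisectionExists.ModpBraidOrbits.tubeEndPoint Φ₂ b s r θ, hmem' θ⟩))
          (νt : ℝ → Metric.sphere (0 : EuclideanSpace ℝ (Fin 2)) 1 → EuclideanSpace ℝ (Fin 4)),
          (∀ t θ, ∃ a : ↥(Literature.Topology.FourManifolds.HandleAttachingMap.coresComplement h),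
            (a : M) ∈ Set.range (h i).toFun ∧ Ψ.toFun t θ = D.jA a) ∧
          Literature.Geometry.Symplectic.IsFramingAlong Ψ
            (fun θ => mfderiv (𝓡∂ 4) (𝓡∂ 4)
              (fun a : ↥(Literature.Topology.FourManifolds.HandleAttachingMap.coresComplement h) => D.jA a)
              ⟨(h i).toFun (Summit.SmoothPoincare4.SmoothPoincare4.Theorems.AcyclicBisectionExists.ModpBraidOrbits.tubeLongitudePt b r θ), hmem θ⟩
              (mfderiv (𝓡∂ 4) (𝓡∂ 4) (h i).toFun (Summit.SmoothPoincare4.SmoothPoincare4.Theorems.AcyclicBisectionExists.ModpBraidOrbits.tubeLongitudePt b r θ)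
                ((Literature.Topology.FourManifolds.closedBallCoeDeriv
                  ((Summit.SmoothPoincare4.SmoothPoincare4.Theorems.AcyclicBisectionExists.ModpBraidOrbits.tubeLongitudePt b r θ : ↥(Literature.Topology.FourManifolds.handleTube 3 2)) :
                    Metric.closedBall (0 : EuclideanSpace ℝ (Fin 4)) 1)).symm (Summit.SmoothPoincare4.SmoothPoincare4.Theorems.AcyclicBisectionExists.ModpBraidOrbits.slideEndVec b r θ))))
            νt ∧
          ∀ θ, νt 1 θ = mfderiv (𝓡∂ 4) (𝓡∂ 4) D.jA ⟨Summit.SmoothPoincare4.SmoothPoincare4.Theorems.AcyclicBisectionExists.ModpBraidOrbits.tubeEndPoint Φ₂ b s r θ, hmem' θ⟩ (Summit.SmoothPoincare4.SmoothPoincare4.Theorems.AcyclicBisectionExists.ModpBraidOrbits.tubeEndFraming Φ₂ b s r θ) := by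
  intro ι _ M _ _ _ _ _ h P _ _ _ _ D i b Φ₂ hcore s hs hsgn β hβ hang hsmall
  exact exists_slideEnd_to_tube D i b hcore hs hsgn hβ hang hsmall

end Summit.SmoothPoincare4.SmoothPoincare4.Theorems.AcyclicBisectionExists.ModpBraidOrbits

end
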